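import Summits.CriticalPhenomena.SAWScalingLimit.Theses.SAWDefectDecoherence
import Literature.Probability.RandomPlanarGeometry.HalfPlaneAutomorphism
import Literature.Probability.RandomPlanarGeometry.CritPercCardyFunctionProofs

/-!
# `BoundaryClosureR`, line `pick-half-plane`, stub `stub_identification`: the identification
# target `exp((5/8)(L - L_b))` does not depend on the choice of `(Φ, L, L_b)`

Support file for the crux `BoundaryClosureR` (stmt-CriticalPhenomena-14004) of route
`SAWDefectDecoherence`, line `pick-half-plane`, stub `stub_identification :
PickCupLimits → Identification`.  The stub (and the target `HexObservableLimitR`) quantify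
UNIVERSALLY over the conformal data `(Φ, L, L_b)`: a conformal equivalence
`Φ : Ω → ℍₒ` with `‖Φ‖ → ∞` at the root `D.pt 0` and boundary value `0` at the normaliser
`D.pt 1` (limits within `Ω`), a continuous branch `L` of `log Φ'` on `Ω` and its limit `L_b` at
`D.pt 1` within `Ω`; they assert `g = c · exp((5/8)(L - L_b))` for ONE weak limit `g` and ALL
such data.  This is consistent only if the right-hand side is independent of the data, which this
file proves (the frame audit of the stub, items "uniqueness of `Φ` up to `λ > 0`" and "of `L` up
to `2πiℤ`"):

* `exists_eqOn_smul_of_tendsto_comp` — pushed-forward form of the tree's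
  `ConformalEquiv.exists_eqOn_smul_of_tendsto` (automorphisms of `ℍₒ` fixing the boundary
  points `0` and `∞` are dilations): it suffices to test the two boundary conditions of the
  automorphism `M` along ANY non-trivial filters through a map `f` into `ℍₒ` (`f → 0` and
  `M ∘ f → 0`; `f → ∞` and `M ∘ f → ∞`).  This is what makes Carathéodory's theorem unnecessary
  below: the boundary behaviour of `Φ₁⁻¹` is never used, only that of `Φ₁` and `Φ₂` forward.
* `uniformiser_unique` — **two normalised uniformisers differ by a positive factor**: for any
  set `U`, points `p, q ∈ closure U` and conformal equivalences `Φ₁, Φ₂ : U → ℍₒ` with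
  `‖Φᵢ‖ → ∞` at `p` and `Φᵢ → 0` at `q` (within `U`), `Φ₂ = λ Φ₁` on `U` for some `λ > 0`
  (`Aut(ℍₒ) = PSL(2, ℝ)` is the tree's `ConformalEquiv.exists_eqOn_normalForm`, proved from
  Schwarz's lemma).
* `sub_eq_sub_of_exp_eq_mul_exp` — **two continuous logarithms of functions differing by a
  positive constant factor on a preconnected set, recentred at a common boundary point, agree**:
  `exp L₂ = λ exp L₁` on `U`, `Lᵢ → Lbᵢ` at `q ∈ closure U` within `U` ⇒ `L₂ - Lb₂ = L₁ - Lb₁` on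
  `U` (`L₂ - L₁ ∈ log λ + 2πiℤ` is continuous and integer-valued after normalisation, hence
  constant by the intermediate value theorem on the preconnected `U`, and the constant cancels
  against the limits).
* `identificationTarget_eq` — for a Dobrushin domain and two admissible data
  `(Φ₁, L₁, Lb₁)`, `(Φ₂, L₂, Lb₂)` of the stub: `L₂ - Lb₂ = L₁ - Lb₁` on the carrier, hence
  `c · exp((5/8)(L₂ z - Lb₂)) = c · exp((5/8)(L₁ z - Lb₁))`: the identification target is a
  function of `(D, c)` alone.

References: Lawler, *Conformally Invariant Processes in the Plane* (2005), §6.1 (uniqueness of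
the chordal normalisation up to dilation); Ahlfors, *Complex Analysis* (1979), Ch. 4 §3.4.
-/

noncomputable section

open scoped Topology
open Filter Set Complex Metric Bornology
open UpperHalfPlane (upperHalfPlaneSet isOpen_upperHalfPlaneSet)
open Literature.Probability.RandomPlanarGeometry

namespace Summit.CriticalPhenomena.SAWScalingLimit.Theorems.PickHalfPlane.Identification

/-! ### Automorphisms of `ℍₒ` fixing `0` and `∞`, tested along pushed-forward filters -/

/-- **Dilations, pushed-forward test.** Let `M` be a conformal automorphism of `ℍₒ` and `f` a map
into `ℍₒ` (eventually) along two non-trivial filters `l₀, l₁`.  If `f → ∞` and `M ∘ f → ∞` along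
`l₀`, and `f → 0` and `M ∘ f → 0` along `l₁`, then `M z = λ z` on `ℍₒ` for some `λ > 0`.  Proof as
for the tree's `ConformalEquiv.exists_eqOn_smul_of_tendsto`: in the normal form
`M = q C⁻¹(u C ·) + p` (`exists_eqOn_normalForm`), `u ≠ 1` would give `M` a finite limit at `∞`,
contradicting `M ∘ f → ∞` along `l₀`; so `M z = q z + p`, and `l₁` forces `p = 0`.
Lawler (2005), §6.1. [folklore] -/
theorem exists_eqOn_smul_of_tendsto_comp {α : Type*} {l₀ l₁ : Filter α} [NeBot l₀] [NeBot l₁]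
    (M : ConformalEquiv upperHalfPlaneSet upperHalfPlaneSet) (f : α → ℂ)
    (hf₀ : ∀ᶠ x in l₀, f x ∈ upperHalfPlaneSet) (hf₁ : ∀ᶠ x in l₁, f x ∈ upperHalfPlaneSet)
    (h₀ : Tendsto f l₀ (cocompact ℂ)) (hM₀ : Tendsto (fun x => M (f x)) l₀ (cocompact ℂ))
    (h₁ : Tendsto f l₁ (𝓝 0)) (hM₁ : Tendsto (fun x => M (f x)) l₁ (𝓝 0)) :
    ∃ c : ℝ, 0 < c ∧ EqOn M (fun z => (c : ℂ) * z) upperHalfPlaneSet := by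
  obtain ⟨q, p, hq, u, -, hM⟩ := M.exists_eqOn_normalForm
  -- the condition at `∞` forces `u = 1`
  have hu : u = 1 := by
    by_contra hu
    have hev : (fun x => M (f x)) =ᶠ[l₀] fun x => (q : ℂ) * cayleyInvFun (u * cayleyFun (f x)) + p :=
      hf₀.mono fun x hx => hM hx
    have h := ((ConformalEquiv.tendsto_normalForm_cocompact q p hu).comp h₀).congr' hev.symm
    exact h.not_tendsto (disjoint_nhds_cocompact _) hM₀
  subst hu
  have hM' : EqOn M (fun z => (q : ℂ) * z + p) upperHalfPlaneSet := by
    intro z hz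
    rw [hM hz]
    simp only [one_mul]
    rw [cayleyInvFun_cayleyFun (add_I_ne_zero (le_of_lt hz))]
  -- the condition at `0` forces `p = 0`
  have hp : p = 0 := by
    have hev : (fun x => M (f x)) =ᶠ[l₁] fun x => (q : ℂ) * f x + p :=
      hf₁.mono fun x hx => hM' hx
    have hcont : Tendsto (fun x => (q : ℂ) * f x + p) l₁ (𝓝 ((q : ℂ) * 0 + p)) :=
      (h₁.const_mul _).add_const _
    rw [mul_zero, zero_add] at hcont
    have := tendsto_nhds_unique (hcont.congr' hev.symm) hM₁
    exact_mod_cast this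
  subst hp
  refine ⟨q, hq, fun z hz => ?_⟩
  simp only [hM' hz, ofReal_zero, add_zero]

/-! ### Uniqueness of the normalised uniformiser -/

/-- **Uniqueness of the normalised uniformiser up to a positive factor.** Two conformal
equivalences `Φ₁, Φ₂ : U → ℍₒ` which both tend to `∞` in norm at `p` and to `0` at `q`
(limits within `U`; `p, q ∈ closure U`, e.g. boundary points of a domain) satisfy `Φ₂ = λ Φ₁` on
`U` for some `λ > 0`: the automorphism `M = Φ₂ ∘ Φ₁⁻¹` of `ℍₒ` satisfies `M ∘ Φ₁ = Φ₂`, so it is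
tested by `f = Φ₁` along `𝓝[U] p` and `𝓝[U] q` (`exists_eqOn_smul_of_tendsto_comp`).  No boundary
regularity of `U` and no Carathéodory extension is needed.  Lawler (2005), §6.1 ("any other
such `F̂` can be written as `r F` for some `r > 0`"). [folklore] -/
theorem uniformiser_unique {U : Set ℂ} {p q : ℂ} (hp : p ∈ closure U) (hq : q ∈ closure U)
    (Φ₁ Φ₂ : ConformalEquiv U upperHalfPlaneSet)
    (h₁ : Tendsto (fun z => ‖Φ₁ z‖) (𝓝[U] p) atTop) (h₁' : Φ₁.HasBoundaryValue q 0)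
    (h₂ : Tendsto (fun z => ‖Φ₂ z‖) (𝓝[U] p) atTop) (h₂' : Φ₂.HasBoundaryValue q 0) :
    ∃ c : ℝ, 0 < c ∧ EqOn Φ₂ (fun z => (c : ℂ) * Φ₁ z) U := by
  haveI : NeBot (𝓝[U] p) := mem_closure_iff_nhdsWithin_neBot.1 hp
  haveI : NeBot (𝓝[U] q) := mem_closure_iff_nhdsWithin_neBot.1 hq
  set M : ConformalEquiv upperHalfPlaneSet upperHalfPlaneSet := Φ₁.symm.trans Φ₂ with hMdef
  have hMΦ : ∀ z ∈ U, M (Φ₁ z) = Φ₂ z := fun z hz => by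
    rw [hMdef, ConformalEquiv.trans_apply, Φ₁.symm_apply_apply hz]
  have hmem : ∀ x : ℂ, (∀ᶠ z in 𝓝[U] x, Φ₁ z ∈ upperHalfPlaneSet) := fun x =>
    eventually_mem_nhdsWithin.mono fun z hz => Φ₁.mapsTo hz
  have hev : ∀ x : ℂ, (fun z => M (Φ₁ z)) =ᶠ[𝓝[U] x] Φ₂ := fun x =>
    eventually_mem_nhdsWithin.mono fun z hz => hMΦ z hz
  obtain ⟨c, hc, hMc⟩ := exists_eqOn_smul_of_tendsto_comp M Φ₁ (hmem p) (hmem q)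
    (tendsto_cocompact_complex_of_norm_atTop h₁)
    ((tendsto_cocompact_complex_of_norm_atTop h₂).congr' (hev p).symm) h₁'
    ((show Tendsto Φ₂ (𝓝[U] q) (𝓝 0) from h₂').congr' (hev q).symm)
  refine ⟨c, hc, fun z hz => ?_⟩
  rw [← hMΦ z hz]
  exact hMc (Φ₁.mapsTo hz)

/-- The same for the derivatives on an open `U`: `Φ₂' = λ Φ₁'` on `U`. [folklore] -/
theorem deriv_uniformiser_unique {U : Set ℂ} (hU : IsOpen U) {p q : ℂ} (hp : p ∈ closure U)
    (hq : q ∈ closure U) (Φ₁ Φ₂ : ConformalEquiv U upperHalfPlaneSet)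
    (h₁ : Tendsto (fun z => ‖Φ₁ z‖) (𝓝[U] p) atTop) (h₁' : Φ₁.HasBoundaryValue q 0)
    (h₂ : Tendsto (fun z => ‖Φ₂ z‖) (𝓝[U] p) atTop) (h₂' : Φ₂.HasBoundaryValue q 0) :
    ∃ c : ℝ, 0 < c ∧ ∀ z ∈ U, deriv Φ₂ z = (c : ℂ) * deriv Φ₁ z := by
  obtain ⟨c, hc, hEq⟩ := uniformiser_unique hp hq Φ₁ Φ₂ h₁ h₁' h₂ h₂'
  refine ⟨c, hc, fun z hz => ?_⟩
  have hev : (Φ₂ : ℂ → ℂ) =ᶠ[𝓝 z] fun w => (c : ℂ) * Φ₁ w :=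
    Filter.eventuallyEq_of_mem (hU.mem_nhds hz) hEq
  rw [hev.deriv_eq]
  exact deriv_const_mul _ ((Φ₁.differentiableOn z hz).differentiableAt (hU.mem_nhds hz))

/-! ### Two recentred continuous logarithms agree -/

/-- **Recentred continuous logarithms agree.** On a preconnected set `U`, let `L₁, L₂` be
continuous with `exp (L₂ z) = λ · exp (L₁ z)` for a real `λ > 0`, and let `Lᵢ → Lbᵢ` at a point
`q ∈ closure U` within `U`.  Then `L₂ z - Lb₂ = L₁ z - Lb₁` for every `z ∈ U`: the continuous
function `L₂ - L₁ - log λ` takes values in `2πiℤ`, so by the intermediate value theorem on the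
preconnected `U` it is a constant `2πik`, and `Lb₂ - Lb₁ = log λ + 2πik` as well.
Ahlfors (1979), Ch. 4 §3.4 (branches of the logarithm). [folklore] -/
theorem sub_eq_sub_of_exp_eq_mul_exp {U : Set ℂ} (hU : IsPreconnected U) {q : ℂ}
    (hq : q ∈ closure U) {L₁ L₂ : ℂ → ℂ} (hL₁ : ContinuousOn L₁ U) (hL₂ : ContinuousOn L₂ U)
    {c : ℝ} (hc : 0 < c) (h : ∀ z ∈ U, exp (L₂ z) = (c : ℂ) * exp (L₁ z))
    {Lb₁ Lb₂ : ℂ} (hb₁ : Tendsto L₁ (𝓝[U] q) (𝓝 Lb₁)) (hb₂ : Tendsto L₂ (𝓝[U] q) (𝓝 Lb₂)) :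
    ∀ z ∈ U, L₂ z - Lb₂ = L₁ z - Lb₁ := by
  haveI : NeBot (𝓝[U] q) := mem_closure_iff_nhdsWithin_neBot.1 hq
  -- the difference is `log c + 2πi n(z)` with `n(z) ∈ ℤ`
  have key : ∀ z ∈ U, ∃ n : ℤ, L₂ z - L₁ z - (Real.log c : ℂ) = n * (2 * Real.pi * I) := by
    intro z hz
    refine Complex.exp_eq_one_iff.1 ?_
    rw [Complex.exp_sub, Complex.exp_sub, h z hz, Complex.ofReal_log hc.le,
      Complex.exp_log (by exact_mod_cast hc.ne')]
    have hc' : (c : ℂ) ≠ 0 := by exact_mod_cast hc.ne'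
    field_simp [Complex.exp_ne_zero (L₁ z)]
  choose! n hn using key
  -- the integer `n` is a continuous function on `U`, read off from the imaginary part
  set f : ℂ → ℝ := fun z => (L₂ z - L₁ z - (Real.log c : ℂ)).im / (2 * Real.pi) with hfdef
  have hfn : ∀ z ∈ U, f z = n z := by
    intro z hz
    simp only [hfdef, hn z hz, mul_im, intCast_re, intCast_im, mul_re, re_ofNat, ofReal_re,
      im_ofNat, ofReal_im, mul_zero, sub_zero, I_im, mul_one, zero_mul, add_zero, I_re]
    field_simp
  have hfc : ContinuousOn f U :=
    ((continuous_im.comp_continuousOn ((hL₂.sub hL₁).sub continuousOn_const)).div_const _)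
  -- hence constant, by the intermediate value theorem on the preconnected `U`
  have hconst : ∀ z₁ ∈ U, ∀ z₂ ∈ U, n z₁ = n z₂ := by
    by_contra! hne
    obtain ⟨z₁, hz₁, z₂, hz₂, h12⟩ := hne
    -- arrange `n z₁ < n z₂`
    wlog hlt : n z₁ < n z₂ generalizing z₁ z₂
    · exact this z₂ hz₂ z₁ hz₁ (Ne.symm h12) (lt_of_le_of_ne (not_lt.1 hlt) (Ne.symm h12))
    have hmem : ((n z₁ : ℝ) + 1 / 2) ∈ Icc (f z₁) (f z₂) := by
      rw [hfn z₁ hz₁, hfn z₂ hz₂]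
      constructor
      · linarith
      · have : (n z₁ : ℝ) + 1 ≤ n z₂ := by exact_mod_cast hlt
        linarith
    obtain ⟨z, hz, hzval⟩ := hU.intermediate_value hz₁ hz₂ hfc hmem
    rw [hfn z hz] at hzval
    have h2 : (2 * n z : ℝ) = 2 * n z₁ + 1 := by linarith
    have h3 : 2 * n z = 2 * n z₁ + 1 := by exact_mod_cast h2
    omega
  -- evaluate the constant against the limits at `q`
  intro z hz
  have hdiff : ∀ w ∈ U, L₂ w - L₁ w = (Real.log c : ℂ) + n z * (2 * Real.pi * I) := by
    intro w hw
    rw [← hconst w hw z hz, ← hn w hw]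
    ring
  have hlim : Tendsto (fun w => L₂ w - L₁ w) (𝓝[U] q) (𝓝 (Lb₂ - Lb₁)) := hb₂.sub hb₁
  have hlim' : Tendsto (fun w => L₂ w - L₁ w) (𝓝[U] q)
      (𝓝 ((Real.log c : ℂ) + n z * (2 * Real.pi * I))) :=
    tendsto_const_nhds.congr' (eventually_mem_nhdsWithin.mono fun w hw => (hdiff w hw).symm)
  have hb : Lb₂ - Lb₁ = (Real.log c : ℂ) + n z * (2 * Real.pi * I) := tendsto_nhds_unique hlim hlim'
  have := hdiff z hz
  linear_combination this - hb

/-! ### The identification target is independent of the conformal data -/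

/-- **The identification target `exp((5/8)(L - L_b))` of the stub `stub_identification` (and of
the target `HexObservableLimitR`) does not depend on the admissible conformal data.** For a
Dobrushin domain `D` and two data `(Φᵢ, Lᵢ, Lbᵢ)` — `Φᵢ : D.carrier → ℍₒ` conformal with
`‖Φᵢ‖ → ∞` at `D.pt 0` and boundary value `0` at `D.pt 1`, `Lᵢ` continuous on the carrier with
`exp Lᵢ = Φᵢ'` there and `Lᵢ → Lbᵢ` at `D.pt 1` within the carrier — one has
`L₂ - Lb₂ = L₁ - Lb₁` on the carrier (`Φ₂ = λ Φ₁`, `uniformiser_unique`; `Φ₂' = λ Φ₁'` on the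
open carrier; the carrier is connected and `D.pt 1` lies in its closure, so
`sub_eq_sub_of_exp_eq_mul_exp` applies). [folklore] -/
theorem identificationTarget_sub_eq : ∀ (D : DobrushinDomain)
    (Φ₁ Φ₂ : ConformalEquiv D.carrier upperHalfPlaneSet) (L₁ L₂ : ℂ → ℂ) (Lb₁ Lb₂ : ℂ),
    Tendsto (fun z => ‖Φ₁ z‖) (𝓝[D.carrier] (D.pt 0)) atTop →
    Φ₁.HasBoundaryValue (D.pt 1) 0 → ContinuousOn L₁ D.carrier →
    (∀ z ∈ D.carrier, Complex.exp (L₁ z) = deriv Φ₁ z) →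
    Tendsto L₁ (𝓝[D.carrier] (D.pt 1)) (𝓝 Lb₁) →
    Tendsto (fun z => ‖Φ₂ z‖) (𝓝[D.carrier] (D.pt 0)) atTop →
    Φ₂.HasBoundaryValue (D.pt 1) 0 → ContinuousOn L₂ D.carrier →
    (∀ z ∈ D.carrier, Complex.exp (L₂ z) = deriv Φ₂ z) →
    Tendsto L₂ (𝓝[D.carrier] (D.pt 1)) (𝓝 Lb₂) →
    ∀ z ∈ D.carrier, L₂ z - Lb₂ = L₁ z - Lb₁ := by
  intro D Φ₁ Φ₂ L₁ L₂ Lb₁ Lb₂ h₁ h₁' hL₁ he₁ hb₁ h₂ h₂' hL₂ he₂ hb₂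
  have hp : D.pt 0 ∈ closure D.carrier := frontier_subset_closure (D.pt_mem_frontier 0)
  have hq : D.pt 1 ∈ closure D.carrier := frontier_subset_closure (D.pt_mem_frontier 1)
  obtain ⟨c, hc, hderiv⟩ := deriv_uniformiser_unique D.isOpen hp hq Φ₁ Φ₂ h₁ h₁' h₂ h₂'
  refine sub_eq_sub_of_exp_eq_mul_exp D.isConnected.isPreconnected hq hL₁ hL₂ hc
    (fun z hz => ?_) hb₁ hb₂
  rw [he₂ z hz, he₁ z hz, hderiv z hz]

/-- Hence the right-hand side of the identification, `c · exp((5/8)(L z - L_b))`, is the same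
function on the carrier for all admissible conformal data `(Φ, L, L_b)`: the universal
quantification over these data in `stub_identification` / `HexObservableLimitR` is harmless
(the statements are not vacuously strong on this account). [folklore] -/
theorem identificationTarget_eq (D : DobrushinDomain) (c : ℂ)
    (Φ₁ Φ₂ : ConformalEquiv D.carrier upperHalfPlaneSet) (L₁ L₂ : ℂ → ℂ) (Lb₁ Lb₂ : ℂ)
    (h₁ : Tendsto (fun z => ‖Φ₁ z‖) (𝓝[D.carrier] (D.pt 0)) atTop)
    (h₁' : Φ₁.HasBoundaryValue (D.pt 1) 0) (hL₁ : ContinuousOn L₁ D.carrier)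
    (he₁ : ∀ z ∈ D.carrier, exp (L₁ z) = deriv Φ₁ z)
    (hb₁ : Tendsto L₁ (𝓝[D.carrier] (D.pt 1)) (𝓝 Lb₁))
    (h₂ : Tendsto (fun z => ‖Φ₂ z‖) (𝓝[D.carrier] (D.pt 0)) atTop)
    (h₂' : Φ₂.HasBoundaryValue (D.pt 1) 0) (hL₂ : ContinuousOn L₂ D.carrier)
    (he₂ : ∀ z ∈ D.carrier, exp (L₂ z) = deriv Φ₂ z)
    (hb₂ : Tendsto L₂ (𝓝[D.carrier] (D.pt 1)) (𝓝 Lb₂)) :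
    ∀ z ∈ D.carrier,
      c * exp ((5 / 8 : ℂ) * (L₂ z - Lb₂)) = c * exp ((5 / 8 : ℂ) * (L₁ z - Lb₁)) := by
  intro z hz
  rw [identificationTarget_sub_eq D Φ₁ Φ₂ L₁ L₂ Lb₁ Lb₂ h₁ h₁' hL₁ he₁ hb₁ h₂ h₂' hL₂ he₂ hb₂ z hz]

end Summit.CriticalPhenomena.SAWScalingLimit.Theorems.PickHalfPlane.Identification

end
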